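import Summits.QuantumFields.Balaban3D.Carriers.Formula10
import Summits.QuantumFields.Balaban3D.Proofs.FibreFormula

/-!
# `Summit.QuantumFields.Balaban3D.Proofs.AxialGauge` — THE GAUGE-FIXED FIBRE OF THE LANE'S AXIAL AVERAGING: for a gauge-invariant integrable
# density, `(Tρ)(V) = ∫ ρ(axGlue V W) dW` dV-a.e., where `axGlue V W` is `1` on the radial forest of every block, `V(c)` on the CROSSING bond of
# the line of every coarse bond `c`, and the free Haar variable `W(b)` on every other bond — [Balaban1985UV3] (10) p. 258 «∫dU δ(ŪV^{−1})
# δ_{Ax(Ω₁)}(U) …» and (13) p. 259 «∫dU′↾_{Ω₁} δ((U′U₁)‾(Ū₁)^{−1}) δ_{Ax(Ω₁)}(U′) …» with BOTH δ-functions resolved as an honest finite-dimensional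
# Haar integral for the decimation average (seat p4, lane `pub-balaban3d`; the F4 step of the R3D-01 discharge programme, HOME/drafts/p4/FIBRE49.md)

HONEST FRAMING (lane PLAN.md §0, binding): see `…Proofs.SectAFirstStep`.  [folklore] measure theory over the tree's axial average
(`AveragingRT.axialAvg`), seat p1's radial forest (`Carriers.RadialForest.radialBonds`, `Carriers.Formula10.integral_eq_integral_fixTo_of_treeOrder`)
and seat p4's fibre framework (`…Proofs.FibreFormula`); nothing of the paper is asserted.  For the DECIMATION average `Ū(c) = U(Γ_c)` the printed
constraint surface «Q(A′, c) = 0» of (14)–(16) is LINEAR: in the radial axial gauge every bond of the line of `c` but the crossing one is a forest bond,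
so `Ū(c) = U(crossing bond of c)` and the fibre `{Ū = V}` is the affine slice «crossing bonds := V».

WHAT THIS FILE PROVES (no `sorry`, axioms standard), standing range `j + 1 ≤ m + K`:
* §1 geometry: `crossBond c := line c ((L−1)/2)`; every OTHER bond of a line is in the radial forest of all blocks (`line_mem_radialBonds`), the
  crossing bond is not (`crossBond_not_mem_radialBonds`), `crossBond` is injective;
* §2 algebra: the head factor `pathProd U c (mid P)` and `tailProd` (transports along the two half-lines), `pathProd_eq_head_mul_cross_mul_tail`, the CROSSING PARAMETRISATION
  `crossParam V W` (`W` with the crossing bond of each line replaced by `head⁻¹·V(c)·tail⁻¹`) with `axialAvg_crossParam : (crossParam V W)‾ = V`,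
  its right-translation skew identity and its covariance under gauge transformations trivial at the block centres;
* §3 measure: `map_crossParam : (dV ⊗ dW).map crossParam = dU` (Weil uniqueness, as in `…Proofs.AxialFibre`), `isFibreParam_cross`, hence
  `rnTransport_cross_ae_eq : Tρ =ᵐ ∫ ρ(crossParam · W) dW`;
* (sibling `…Proofs.AxialGaugeFix`, split for the 400-line rule) gauge fixing: for GAUGE-INVARIANT `ρ` the forest variables may be set to `1`
  inside the fibre integral (tree-gauge theorem at the fresh ends, which are never block centres), `crossParam V (W[forest := 1]) = axGlue V W`,
  and **`rnTransport_axialGauge_ae_eq`**.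
-/

noncomputable section

namespace Summit.QuantumFields.Balaban3D.Proofs.AxialGauge

open _root_.MeasureTheory
open Literature.MathematicalPhysics.QuantumFieldTheory.Balaban1983to89
open Literature.MathematicalPhysics.QuantumFieldTheory.Balaban1983to89.AveragingRT
open Literature.MathematicalPhysics.QuantumFieldTheory.Balaban1983to89.T4TreeGaugeFixing (fixTo fixTo_apply_of_mem fixTo_apply_of_not_mem)
open Summit.QuantumFields.Balaban3D.Carriers

variable {P : Params} {j : ℕ} {G : Type*} [GaugeGroup G]

/-! ## §1 Geometry: the crossing bond of a line; all other line bonds are radial -/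

/-- `(L−1)/2`, the index of the crossing bond on a line (`L` odd). [folklore] -/
abbrev mid (P : Params) : ℕ := (P.L - 1) / 2

/-- THE CROSSING BOND of the line of the coarse bond `c`: the `(L−1)/2`-th bond, joining the block `B(c₋)` to the block `B(c₊)`. [folklore] -/
def crossBond (c : PBond P (j + 1)) : PBond P j := line c (mid P)

omit [GaugeGroup G] in
/-- Offsets of block sites: `off (blockSite y r) κ = r κ`. [folklore] -/
theorem off_blockSite (hj : j + 1 ≤ P.m + P.K) (y : Site P (j + 1)) (r : Fin P.d → Fin P.L) (κ : Fin P.d) :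
    off (Site.blockSite y r) κ = r κ := by
  unfold off
  rw [Site.val_blockSite hj, Nat.mul_add_mod', Nat.mod_eq_of_lt (r κ).isLt]

omit [GaugeGroup G] in
/-- Every bond of a line OTHER than the crossing one lies in the radial forest of all blocks (its offset along the line direction is `< L − 1`,
the other offsets are central). [folklore] -/
theorem line_mem_radialBonds (hj : j + 1 ≤ P.m + P.K) (c : PBond P (j + 1)) {t : ℕ} (ht : t < P.L) (hne : t ≠ mid P) :
    line c t ∈ radialBonds (Finset.univ : Finset (Site P (j + 1))) := by
  have hL := P.hL.2
  obtain ⟨k, hk⟩ := P.hL.1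
  rw [mem_radialBonds]
  refine ⟨Finset.mem_univ _, ?_, ?_⟩
  · show off (lineSite c t) c.dir < P.L - 1
    by_cases hlo : t ≤ mid P
    · rw [lineSite_eq_lo hj c hlo, off_blockSite hj]
      simp only [offLo, if_true]
      have : t < mid P := lt_of_le_of_ne hlo hne
      unfold mid at this; omega
    · rw [lineSite_eq_hi hj c (lt_of_not_ge hlo) ht.le, off_blockSite hj]
      simp only [offHi, if_true]
      unfold mid at hlo; omega
  · intro κ hκ
    show off (lineSite c t) κ = (P.L - 1) / 2
    have hκ' : κ ≠ c.dir := ne_of_lt hκ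
    by_cases hlo : t ≤ mid P
    · rw [lineSite_eq_lo hj c hlo, off_blockSite hj]; simp only [offLo, if_neg hκ']
    · rw [lineSite_eq_hi hj c (lt_of_not_ge hlo) ht.le, off_blockSite hj]; simp only [offHi, if_neg hκ']

omit [GaugeGroup G] in
/-- The crossing bond is NOT a radial bond (its offset along the line direction is `L − 1`), for any set of blocks. [folklore] -/
theorem crossBond_not_mem_radialBonds (hj : j + 1 ≤ P.m + P.K) (Ω : Finset (Site P (j + 1))) (c : PBond P (j + 1)) :
    crossBond c ∉ radialBonds Ω := by
  have hL := P.hL.2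
  obtain ⟨k, hk⟩ := P.hL.1
  intro h
  have h2 := (mem_radialBonds.1 h).2.1
  change off (lineSite c (mid P)) c.dir < P.L - 1 at h2
  rw [lineSite_eq_lo hj c le_rfl, off_blockSite hj] at h2
  simp only [offLo, if_true] at h2
  omega

omit [GaugeGroup G] in
/-- A non-crossing line bond is never the crossing bond of ANY line. [folklore] -/
theorem line_ne_crossBond (hj : j + 1 ≤ P.m + P.K) (c c' : PBond P (j + 1)) {t : ℕ} (ht : t < P.L) (hne : t ≠ mid P) :
    line c t ≠ crossBond c' := fun h =>
  crossBond_not_mem_radialBonds hj Finset.univ c' (h ▸ line_mem_radialBonds hj c ht hne)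

omit [GaugeGroup G] in
/-- Distinct lines have distinct crossing bonds. [folklore] -/
theorem crossBond_injective (hj : j + 1 ≤ P.m + P.K) : Function.Injective (crossBond : PBond P (j + 1) → PBond P j) := by
  intro c c' h
  simp only [crossBond, line, PBond.mk.injEq] at h
  obtain ⟨hs, hdir⟩ := h
  rw [lineSite_eq_lo hj c le_rfl, lineSite_eq_lo hj c' le_rfl] at hs
  have hsrc := (blockSite_inj hj hs).1
  cases c; cases c'; simp_all

/-! ## §2 Algebra: half-line transports and the crossing parametrisation -/

/-- Transport along the bonds `t₀+1, …, t₀+n` of the line of `c` (ordered product). [folklore] -/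
def tailProd (U : GaugeField P j G) (c : PBond P (j + 1)) : ℕ → G
  | 0 => 1
  | n + 1 => tailProd U c n * U (line c (mid P + 1 + n))

/-- The transport along the whole line splits at the crossing bond: `U(Γ_c) = head · U(crossing bond) · tail` with
`head = pathProd U c ((L−1)/2)` and `tail = tailProd U c ((L−1)/2)` (`L = 2·((L−1)/2) + 1`). [folklore] -/
theorem pathProd_eq_head_mul_cross_mul_tail (U : GaugeField P j G) (c : PBond P (j + 1)) :
    ∀ n, pathProd U c (mid P + 1 + n) = pathProd U c (mid P) * U (crossBond c) * tailProd U c n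
  | 0 => by simp [pathProd, tailProd, crossBond]
  | n + 1 => by
    show pathProd U c (mid P + 1 + n) * U (line c (mid P + 1 + n)) = _
    rw [pathProd_eq_head_mul_cross_mul_tail U c n]
    simp only [tailProd, mul_assoc]

/-- `U(Γ_c) = head · U(crossing bond) · tail`. [folklore] -/
theorem axialAvg_eq_head_mul_cross_mul_tail (U : GaugeField P j G) (c : PBond P (j + 1)) :
    axialAvg U c = pathProd U c (mid P) * U (crossBond c) * tailProd U c (mid P) := by
  have h := pathProd_eq_head_mul_cross_mul_tail U c (mid P)
  have hL : mid P + 1 + mid P = P.L := by unfold mid; obtain ⟨k, hk⟩ := P.hL.1; omega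
  rw [hL] at h
  exact h

/-- The head transport does not see the crossing bonds: it is unchanged when the field is modified only there. [folklore] -/
theorem pathProd_congr_off_cross (hj : j + 1 ≤ P.m + P.K) (U U' : GaugeField P j G) (c : PBond P (j + 1))
    (h : ∀ b, (∀ c', b ≠ crossBond c') → U' b = U b) : ∀ n, n ≤ mid P → pathProd U' c n = pathProd U c n
  | 0, _ => rfl
  | n + 1, hn => by
    have hL := P.hL.2
    show pathProd U' c n * U' (line c n) = pathProd U c n * U (line c n)
    rw [pathProd_congr_off_cross hj U U' c h n (by omega),
      h _ (fun c' => line_ne_crossBond hj c c' (by unfold mid at hn; omega) (by omega))]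

/-- The tail transport does not see the crossing bonds either. [folklore] -/
theorem tailProd_congr_off_cross (hj : j + 1 ≤ P.m + P.K) (U U' : GaugeField P j G) (c : PBond P (j + 1))
    (h : ∀ b, (∀ c', b ≠ crossBond c') → U' b = U b) : ∀ n, n ≤ mid P → tailProd U' c n = tailProd U c n
  | 0, _ => rfl
  | n + 1, hn => by
    have hL : mid P + 1 + mid P = P.L := by unfold mid; obtain ⟨k, hk⟩ := P.hL.1; omega
    show tailProd U' c n * U' (line c (mid P + 1 + n)) = tailProd U c n * U (line c (mid P + 1 + n))
    rw [tailProd_congr_off_cross hj U U' c h n (by omega),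
      h _ (fun c' => line_ne_crossBond hj c c' (by omega) (by omega))]

/-- Extension of a function of the coarse bonds to the fine bonds through the crossing bonds (`1` elsewhere). [folklore] -/
def crossExt (g : PBond P (j + 1) → G) : PBond P j → G :=
  Function.extend (crossBond : PBond P (j + 1) → PBond P j) g fun _ => 1

/-- On a crossing bond, `crossExt g = g c`. [folklore] -/
theorem crossExt_cross (hj : j + 1 ≤ P.m + P.K) (g : PBond P (j + 1) → G) (c : PBond P (j + 1)) :
    crossExt g (crossBond c) = g c :=
  (crossBond_injective hj).extend_apply g (fun _ => (1 : G)) c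

/-- Off the crossing bonds, `crossExt g = 1`. [folklore] -/
theorem crossExt_of_not_cross (g : PBond P (j + 1) → G) {b : PBond P j} (hb : ∀ c, b ≠ crossBond c) : crossExt g b = 1 :=
  Function.extend_apply' g (fun _ => (1 : G)) b (fun ⟨c, hc⟩ => hb c hc.symm)

/-- **THE CROSSING PARAMETRISATION**: `Φ(V, W)(b) = W(b)` except on the crossing bond of each line, where
`Φ(V, W)(crossBond c) = head(W)⁻¹ · V(c) · tail(W)⁻¹` — so that the transport along the line is exactly `V(c)`. [folklore] -/
def crossParam (V : GaugeField P (j + 1) G) (W : GaugeField P j G) : GaugeField P j G :=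
  fun b => W b * crossExt (fun c => (W (crossBond c))⁻¹ * ((pathProd W c (mid P))⁻¹ * V c * (tailProd W c (mid P))⁻¹)) b

/-- `Φ(V, W)` agrees with `W` off the crossing bonds. [folklore] -/
theorem crossParam_of_not_cross (V : GaugeField P (j + 1) G) (W : GaugeField P j G) {b : PBond P j}
    (hb : ∀ c, b ≠ crossBond c) : crossParam V W b = W b := by
  unfold crossParam; rw [crossExt_of_not_cross _ hb, mul_one]

/-- `Φ(V, W)` on a crossing bond. [folklore] -/
theorem crossParam_cross (hj : j + 1 ≤ P.m + P.K) (V : GaugeField P (j + 1) G) (W : GaugeField P j G) (c : PBond P (j + 1)) :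
    crossParam V W (crossBond c) = (pathProd W c (mid P))⁻¹ * V c * (tailProd W c (mid P))⁻¹ := by
  unfold crossParam; rw [crossExt_cross hj, mul_inv_cancel_left]

/-- **`Φ(V, W)` lies in the fibre of `V`**: `(crossParam V W)‾ = V`. [folklore] -/
theorem axialAvg_crossParam (hj : j + 1 ≤ P.m + P.K) (V : GaugeField P (j + 1) G) (W : GaugeField P j G) :
    axialAvg (crossParam V W) = V := by
  funext c
  rw [axialAvg_eq_head_mul_cross_mul_tail, crossParam_cross hj,
    pathProd_congr_off_cross hj W (crossParam V W) c (fun b hb => crossParam_of_not_cross V W hb) _ le_rfl,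
    tailProd_congr_off_cross hj W (crossParam V W) c (fun b hb => crossParam_of_not_cross V W hb) _ le_rfl]
  group

/-- Under a right translation `W ↦ W·k′` the crossing value transforms by the two-sided, `W`-dependent translation
`V(c) ↦ a_c(W)·V(c)·b_c(W)`; this is the coarse component of the skew change of variables. [folklore] -/
def skewMap (k' : PBond P j → G) (p : GaugeField P (j + 1) G × GaugeField P j G) :
    GaugeField P (j + 1) G × GaugeField P j G :=
  (fun c => pathProd (fun b => p.2 b * k' b) c (mid P) * (pathProd p.2 c (mid P))⁻¹ * p.1 c *
      ((tailProd p.2 c (mid P))⁻¹ * k' (crossBond c) * tailProd (fun b => p.2 b * k' b) c (mid P)),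
    fun b => p.2 b * k' b)

/-- Right translation of the fine field commutes past the parametrisation up to `skewMap`:
`Φ(V, W)·k′ = Φ(skewMap k′ (V, W))`. [folklore] -/
theorem crossParam_mul (hj : j + 1 ≤ P.m + P.K) (k' : PBond P j → G) (p : GaugeField P (j + 1) G × GaugeField P j G) :
    (fun b => crossParam p.1 p.2 b * k' b) = crossParam (skewMap k' p).1 (skewMap k' p).2 := by
  funext b
  by_cases hb : ∃ c : PBond P (j + 1), crossBond c = b
  · obtain ⟨c, rfl⟩ := hb
    rw [crossParam_cross hj, crossParam_cross hj]
    show _ = (pathProd (fun b => p.2 b * k' b) c (mid P))⁻¹ *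
      (pathProd (fun b => p.2 b * k' b) c (mid P) * (pathProd p.2 c (mid P))⁻¹ * p.1 c *
        ((tailProd p.2 c (mid P))⁻¹ * k' (crossBond c) * tailProd (fun b => p.2 b * k' b) c (mid P))) *
      (tailProd (fun b => p.2 b * k' b) c (mid P))⁻¹
    group
  · have hb' : ∀ c, b ≠ crossBond c := fun c h => hb ⟨c, h.symm⟩
    rw [crossParam_of_not_cross _ _ hb', crossParam_of_not_cross _ _ hb']
    rfl

/-! ## §3 Measurability and the push-forward `Φ_*(dV ⊗ dW) = dU` -/

section Measure

variable [MeasurableSpace G] [HaarData G] [MeasurableMul₂ G] [MeasurableInv G]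

omit [HaarData G] [MeasurableInv G] in
/-- The tail transports are measurable functions of the field. [folklore] -/
theorem measurable_tailProd (c : PBond P (j + 1)) : ∀ n, Measurable fun U : GaugeField P j G => tailProd U c n
  | 0 => measurable_const
  | n + 1 => (measurable_tailProd c n).mul (measurable_pi_apply _)

omit [HaarData G] in
/-- Each coordinate of `Φ` is a measurable function of `(V, W)`. [folklore] -/
theorem measurable_crossParam (hj : j + 1 ≤ P.m + P.K) :
    Measurable fun p : GaugeField P (j + 1) G × GaugeField P j G => crossParam p.1 p.2 := by
  refine measurable_pi_iff.mpr fun b => ?_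
  by_cases hb : ∃ c : PBond P (j + 1), crossBond c = b
  · obtain ⟨c, rfl⟩ := hb
    have h : (fun p : GaugeField P (j + 1) G × GaugeField P j G => crossParam p.1 p.2 (crossBond c))
        = fun p => (pathProd p.2 c (mid P))⁻¹ * p.1 c * (tailProd p.2 c (mid P))⁻¹ := by
      funext p; rw [crossParam_cross hj]
    rw [h]
    exact ((((measurable_pathProd c _).comp measurable_snd).inv.mul ((measurable_pi_apply c).comp measurable_fst)).mul
      ((measurable_tailProd c _).comp measurable_snd).inv)
  · have hb' : ∀ c, b ≠ crossBond c := fun c h => hb ⟨c, h.symm⟩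
    have h : (fun p : GaugeField P (j + 1) G × GaugeField P j G => crossParam p.1 p.2 b) = fun p => p.2 b := by
      funext p; rw [crossParam_of_not_cross _ _ hb']
    rw [h]
    exact (measurable_pi_apply _).comp measurable_snd

/-- The change of variables `skewMap k′` preserves `dV ⊗ dW` (a skew product over the measure-preserving `W ↦ W·k′`, each fibre
map a two-sided translation of `dV`). [folklore] -/
theorem measurePreserving_skew (k' : PBond P j → G) :
    MeasurePreserving (skewMap (P := P) (G := G) (j := j) k')
      ((fieldMeasure P (j + 1) G).prod (fieldMeasure P j G)) ((fieldMeasure P (j + 1) G).prod (fieldMeasure P j G)) := by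
  -- the two coefficient fields `a(W)`, `b(W)` and the fibre map `g W V`
  let a : GaugeField P j G → GaugeField P (j + 1) G :=
    fun W c => pathProd (fun b => W b * k' b) c (mid P) * (pathProd W c (mid P))⁻¹
  let bb : GaugeField P j G → GaugeField P (j + 1) G :=
    fun W c => (tailProd W c (mid P))⁻¹ * k' (crossBond c) * tailProd (fun b => W b * k' b) c (mid P)
  have hR : Measurable fun W : GaugeField P j G => (fun b => W b * k' b) := (measurePreserving_mulRight k').measurable
  have ha_meas : Measurable a := by
    refine measurable_pi_iff.mpr fun c => ?_
    exact ((measurable_pathProd c _).comp hR).mul (measurable_pathProd c _).inv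
  have hb_meas : Measurable bb := by
    refine measurable_pi_iff.mpr fun c => ?_
    exact ((measurable_tailProd c _).inv.mul measurable_const).mul ((measurable_tailProd c _).comp hR)
  let g : GaugeField P j G → GaugeField P (j + 1) G → GaugeField P (j + 1) G := fun W V c => a W c * V c * bb W c
  have hg_meas : Measurable (Function.uncurry g) := by
    refine measurable_pi_iff.mpr fun c => ?_
    exact (((measurable_pi_apply c).comp (ha_meas.comp measurable_fst)).mul
      ((measurable_pi_apply c).comp measurable_snd)).mul ((measurable_pi_apply c).comp (hb_meas.comp measurable_fst))
  have hg_pres : ∀ W, Measure.map (g W) (fieldMeasure P (j + 1) G) = fieldMeasure P (j + 1) G := fun W => by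
    have hcomp : g W = (fun (V : GaugeField P (j + 1) G) (c : PBond P (j + 1)) => V c * bb W c) ∘
        (fun (V : GaugeField P (j + 1) G) (c : PBond P (j + 1)) => a W c * V c) := by
      funext V c; rfl
    rw [hcomp]
    exact ((measurePreserving_mulRight (P := P) (j := j + 1) (bb W)).comp (measurePreserving_mulLeft (a W))).map_eq
  let R : GaugeField P j G → GaugeField P j G := fun W b => W b * k' b
  have hRW : MeasurePreserving R (fieldMeasure P j G) (fieldMeasure P j G) := measurePreserving_mulRight k'
  have hswap₁ : MeasurePreserving (Prod.swap : GaugeField P (j + 1) G × GaugeField P j G → GaugeField P j G × GaugeField P (j + 1) G)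
      ((fieldMeasure P (j + 1) G).prod (fieldMeasure P j G)) ((fieldMeasure P j G).prod (fieldMeasure P (j + 1) G)) :=
    Measure.measurePreserving_swap
  have hswap₂ : MeasurePreserving (Prod.swap : GaugeField P j G × GaugeField P (j + 1) G → GaugeField P (j + 1) G × GaugeField P j G)
      ((fieldMeasure P j G).prod (fieldMeasure P (j + 1) G)) ((fieldMeasure P (j + 1) G).prod (fieldMeasure P j G)) :=
    Measure.measurePreserving_swap
  have hskew : MeasurePreserving (fun p : GaugeField P j G × GaugeField P (j + 1) G => (R p.1, g p.1 p.2))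
      ((fieldMeasure P j G).prod (fieldMeasure P (j + 1) G)) ((fieldMeasure P j G).prod (fieldMeasure P (j + 1) G)) :=
    hRW.skew_product hg_meas (Filter.Eventually.of_forall hg_pres)
  have hcomp := hswap₂.comp (hskew.comp hswap₁)
  have hfun : skewMap (P := P) (G := G) (j := j) k'
      = Prod.swap ∘ ((fun p : GaugeField P j G × GaugeField P (j + 1) G => (R p.1, g p.1 p.2)) ∘ Prod.swap) := by
    funext p
    simp only [Function.comp_apply, Prod.swap, skewMap]
    refine Prod.ext ?_ rfl
    funext c
    show _ = a p.2 c * p.1 c * bb p.2 c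
    simp only [a, bb, mul_assoc]
  rw [hfun]
  exact hcomp

/-- **`Φ_*(dV ⊗ dW) = dU`**: the push-forward of the product measure under the crossing parametrisation is product Haar on the fine
fields (right invariance via `measurePreserving_skew` + `crossParam_mul`, then Weil uniqueness). [folklore] -/
theorem map_crossParam (hj : j + 1 ≤ P.m + P.K) :
    ((fieldMeasure P (j + 1) G).prod (fieldMeasure P j G)).map
        (fun p : GaugeField P (j + 1) G × GaugeField P j G => crossParam p.1 p.2) = fieldMeasure P j G := by
  letI : Group (GaugeField P j G) := Pi.group
  letI : MeasurableMul₂ (GaugeField P j G) := Pi.measurableMul₂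
  have hΦ := measurable_crossParam (P := P) (G := G) hj
  set μ' := ((fieldMeasure P (j + 1) G).prod (fieldMeasure P j G)).map
    (fun p : GaugeField P (j + 1) G × GaugeField P j G => crossParam p.1 p.2) with hμ'
  haveI : IsProbabilityMeasure μ' := Measure.isProbabilityMeasure_map hΦ.aemeasurable
  have h := measure_eq_mass_smul_of_invariant (fieldMeasure P j G) μ' ?_ ?_
  · rw [h, measure_univ, one_smul]
  · intro k
    exact (measurePreserving_mulLeft (P := P) (j := j) k).map_eq
  · intro k'
    have hR : Measurable (fun x : GaugeField P j G => x * k') := measurable_mul_const k'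
    have hΨ := measurePreserving_skew (P := P) (G := G) (j := j) k'
    have hcomp : (fun x : GaugeField P j G => x * k') ∘ (fun p : GaugeField P (j + 1) G × GaugeField P j G => crossParam p.1 p.2)
        = (fun p : GaugeField P (j + 1) G × GaugeField P j G => crossParam p.1 p.2) ∘ skewMap k' := by
      funext p
      exact crossParam_mul hj k' p
    rw [Measure.map_map hR hΦ, hcomp, ← Measure.map_map hΦ hΨ.measurable, hΨ.map_eq]

/-- **The axial average admits the CROSSING fibre parametrisation** (`FibreFormula.IsFibreParam`, fibre law `dW`). [folklore] -/
theorem isFibreParam_cross (hj : j + 1 ≤ P.m + P.K) :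
    FibreFormula.IsFibreParam (fieldMeasure P j G) (fun p : GaugeField P (j + 1) G × GaugeField P j G => crossParam p.1 p.2)
      (avg := (axialAvg : GaugeField P j G → GaugeField P (j + 1) G)) where
  measurable_avg := measurable_axialAvg
  measurable := measurable_crossParam hj
  map_eq := map_crossParam hj
  avg_apply := fun V W => axialAvg_crossParam hj V W

/-- The transport as a fibre integral through the crossing parametrisation: `(Tρ)(V) = ∫ ρ(crossParam V W) dW` dV-a.e. for every
integrable `ρ`. [folklore] -/
theorem rnTransport_cross_ae_eq (hj : j + 1 ≤ P.m + P.K) (ρ : Density P j G) (hρ : Integrable ρ (fieldMeasure P j G)) :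
    rnTransport (axialAvg : GaugeField P j G → GaugeField P (j + 1) G) ρ
      =ᵐ[fieldMeasure P (j + 1) G] fun V => ∫ W, ρ (crossParam V W) ∂(fieldMeasure P j G) :=
  FibreFormula.rnTransport_ae_eq_fibreIntegral (isFibreParam_cross hj) ρ hρ

end Measure

end Summit.QuantumFields.Balaban3D.Proofs.AxialGauge

end
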